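import Summits.CriticalPhenomena.CardyFormulaZ2.Theorems.CardyWhiteToColouredSimilarityUpgradeOfRectilinearHeart

/-!
# The heart H3 of `SimilarityUpgrade` is EQUIVALENT to the crux (crux stmt-CriticalPhenomena-4597)

Route `CardyWhiteToColoured`, sub-problem `CardyFormulaZ2`, line `registered` of crux
`Summit.CriticalPhenomena.CardyFormulaZ2.Theses.CardyWhiteToColoured.SimilarityUpgrade`
(continuation lead c3, 2026-08-17).

The line has reduced the crux to ONE registered stub, the heart H3 (`stub_rectilinearHeart`):
`similarityUpgrade_of_rectilinearHeart : H3 → SimilarityUpgrade` (c2, this namespace). This file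
proves the converse, so that

* `rectilinearHeart_iff_similarityUpgrade : H3 ↔ SimilarityUpgrade`

is a tree theorem: the open stub IS the crux in minimal form (a rectilinear conformal rectangle and
the corner-marked box of equal modulus have the same full, similarity-invariant bond-ℤ² crossing
limit), and no reshaping inside this composition can shrink it further — a bedrock certificate for
the planners. The converse is elementary and holds in a stronger form
(`modulus_determines_of_similarityUpgrade`): if the crux holds and `Φ` is a full similarity-invariant
limit, then `Φ R = Φ R'` for ANY two conformal rectangles admitting uniformizing data of equal
cross-ratio (uniqueness of limits along the filter `𝓝[>] 0`, which is non-trivial).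

References: S. Smirnov, C. R. Acad. Sci. 333 (2001), Thm 1; O. Schramm, S. Smirnov, Ann. Probab. 39
(2011), §1.
-/

noncomputable section

namespace Summit.CriticalPhenomena.CardyFormulaZ2.Theorems.SimilarityUpgradeReduction

open Filter Topology Set
open Literature.Probability.RandomPlanarGeometry
open Literature.Probability.Percolation (bondDomainCrossingProb)

/-- **Crux ⇒ the modulus determines full limits** (strong converse). If `SimilarityUpgrade` holds and
the bond-ℤ² crossing probabilities of every conformal rectangle converge to a similarity-invariant
`Φ`, then any two conformal rectangles carrying uniformizing data of equal cross-ratio have the same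
limit: the crux provides `f` with `bondDomainCrossingProb R δ → f (crossRatio x)` for every datum
`(φ, x)` of `R`, and limits along the non-trivial filter `𝓝[>] 0` are unique. -/
theorem modulus_determines_of_similarityUpgrade
    (hU : Summit.CriticalPhenomena.CardyFormulaZ2.Theses.CardyWhiteToColoured.SimilarityUpgrade)
    (Φ : ConformalRectangle → ℝ)
    (hlim : ∀ R : ConformalRectangle, Tendsto (bondDomainCrossingProb R) (𝓝[>] (0 : ℝ)) (𝓝 (Φ R)))
    (hsim : ∀ (R R' : ConformalRectangle) (a w : ℂ), a ≠ 0 →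
      R'.carrier = (fun z : ℂ => a * z + w) '' R.carrier →
      R'.arc 0 = (fun z : ℂ => a * z + w) '' R.arc 0 →
      R'.arc 2 = (fun z : ℂ => a * z + w) '' R.arc 2 → Φ R' = Φ R)
    (R R' : ConformalRectangle)
    (φ : ConformalEquiv UpperHalfPlane.upperHalfPlaneSet R.carrier) (x : Fin 4 → ℝ)
    (φ' : ConformalEquiv UpperHalfPlane.upperHalfPlaneSet R'.carrier) (x' : Fin 4 → ℝ)
    (hx : R.IsUniformizing φ x) (hx' : R'.IsUniformizing φ' x') (hη : crossRatio x = crossRatio x') :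
    Φ R = Φ R' := by
  obtain ⟨f, hf⟩ := hU ⟨Φ, hlim, hsim⟩
  have h1 : Φ R = f (crossRatio x) := tendsto_nhds_unique (hlim R) (hf R φ x hx)
  have h2 : Φ R' = f (crossRatio x') := tendsto_nhds_unique (hlim R') (hf R' φ' x' hx')
  rw [h1, h2, hη]

/-- **Crux ⇒ H3** (the converse of `similarityUpgrade_of_rectilinearHeart`), in the registered
signature of the stub `stub_rectilinearHeart`: the rectilinearity of `R` and the corner-box shape of
`R'` are not even used. -/
theorem rectilinearHeart_of_similarityUpgrade
    (hU : Summit.CriticalPhenomena.CardyFormulaZ2.Theses.CardyWhiteToColoured.SimilarityUpgrade) :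
    ∀ Φ : ConformalRectangle → ℝ,
      (∀ R : ConformalRectangle, Tendsto (bondDomainCrossingProb R) (𝓝[>] (0 : ℝ)) (𝓝 (Φ R))) →
      (∀ (R R' : ConformalRectangle) (a w : ℂ), a ≠ 0 →
        R'.carrier = (fun z : ℂ => a * z + w) '' R.carrier →
        R'.arc 0 = (fun z : ℂ => a * z + w) '' R.arc 0 →
        R'.arc 2 = (fun z : ℂ => a * z + w) '' R.arc 2 → Φ R' = Φ R) →
      ∀ (R R' : ConformalRectangle),
        (∃ S : Finset (ℂ × ℂ), (∀ p ∈ S, p.1.re = p.2.re ∨ p.1.im = p.2.im) ∧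
          frontier R.carrier ⊆ ⋃ p ∈ S, segment ℝ p.1 p.2) →
        (∃ w : ℝ, 0 < w ∧ R'.carrier = (Ioo (0 : ℝ) w ×ℂ Ioo (0 : ℝ) 1) ∧
          R'.arc 0 = {z : ℂ | z.re = 0 ∧ z.im ∈ Icc (0 : ℝ) 1} ∧
          R'.arc 2 = {z : ℂ | z.re = w ∧ z.im ∈ Icc (0 : ℝ) 1} ∧
          R'.pt 0 = Complex.I ∧ R'.pt 1 = 0 ∧ R'.pt 2 = (w : ℂ) ∧ R'.pt 3 = (w : ℂ) + Complex.I) →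
        ∀ (φ : ConformalEquiv UpperHalfPlane.upperHalfPlaneSet R.carrier) (x : Fin 4 → ℝ)
          (φ' : ConformalEquiv UpperHalfPlane.upperHalfPlaneSet R'.carrier) (x' : Fin 4 → ℝ),
          R.IsUniformizing φ x → R'.IsUniformizing φ' x' → crossRatio x = crossRatio x' →
          Φ R = Φ R' :=
  fun Φ hlim hsim R R' _ _ φ x φ' x' hx hx' hη =>
    modulus_determines_of_similarityUpgrade hU Φ hlim hsim R R' φ x φ' x' hx hx' hη

/-- **Bedrock certificate: H3 ⟺ the crux.** The registered heart `stub_rectilinearHeart` of line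
`registered` is equivalent to the route decl `SimilarityUpgrade` (forward: the landed composition
`similarityUpgrade_of_rectilinearHeart` of cycles c1–c2 — rectilinear sandwich, box duality, rectangle
continuity, modulus glue; backward: `rectilinearHeart_of_similarityUpgrade`). Consequently every
further reduction of the crux must change the MATHEMATICS (prove a case of H3), not the skeleton. -/
theorem rectilinearHeart_iff_similarityUpgrade :
    (∀ Φ : ConformalRectangle → ℝ,
      (∀ R : ConformalRectangle, Tendsto (bondDomainCrossingProb R) (𝓝[>] (0 : ℝ)) (𝓝 (Φ R))) →
      (∀ (R R' : ConformalRectangle) (a w : ℂ), a ≠ 0 →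
        R'.carrier = (fun z : ℂ => a * z + w) '' R.carrier →
        R'.arc 0 = (fun z : ℂ => a * z + w) '' R.arc 0 →
        R'.arc 2 = (fun z : ℂ => a * z + w) '' R.arc 2 → Φ R' = Φ R) →
      ∀ (R R' : ConformalRectangle),
        (∃ S : Finset (ℂ × ℂ), (∀ p ∈ S, p.1.re = p.2.re ∨ p.1.im = p.2.im) ∧
          frontier R.carrier ⊆ ⋃ p ∈ S, segment ℝ p.1 p.2) →
        (∃ w : ℝ, 0 < w ∧ R'.carrier = (Ioo (0 : ℝ) w ×ℂ Ioo (0 : ℝ) 1) ∧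
          R'.arc 0 = {z : ℂ | z.re = 0 ∧ z.im ∈ Icc (0 : ℝ) 1} ∧
          R'.arc 2 = {z : ℂ | z.re = w ∧ z.im ∈ Icc (0 : ℝ) 1} ∧
          R'.pt 0 = Complex.I ∧ R'.pt 1 = 0 ∧ R'.pt 2 = (w : ℂ) ∧ R'.pt 3 = (w : ℂ) + Complex.I) →
        ∀ (φ : ConformalEquiv UpperHalfPlane.upperHalfPlaneSet R.carrier) (x : Fin 4 → ℝ)
          (φ' : ConformalEquiv UpperHalfPlane.upperHalfPlaneSet R'.carrier) (x' : Fin 4 → ℝ),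
          R.IsUniformizing φ x → R'.IsUniformizing φ' x' → crossRatio x = crossRatio x' →
          Φ R = Φ R') ↔
    Summit.CriticalPhenomena.CardyFormulaZ2.Theses.CardyWhiteToColoured.SimilarityUpgrade :=
  ⟨similarityUpgrade_of_rectilinearHeart, rectilinearHeart_of_similarityUpgrade⟩

end Summit.CriticalPhenomena.CardyFormulaZ2.Theorems.SimilarityUpgradeReduction

end
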